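import Mathlib
import HarnessLib
import Summits.NavierStokesRegularity.NavierStokesRegularity.Theorems.QuarterLogPincerTypeIQuantSubcubicExpZoomTypeIBound
import Summits.NavierStokesRegularity.NavierStokesRegularity.Theorems.QuarterLogPincerTypeIQuantSubcubicExpZoomLimit
import Summits.NavierStokesRegularity.NavierStokesRegularity.Theorems.QuarterLogPincerTypeIQuantSubcubicExpZoomSingular

/-!
# Crux `QuarterLogPincer.TypeIQuantSubcubicExp` (stmt-NavierStokesRegularity-24077), line `thin_cascade`:
  the uniform local Type-I bound of the zooms (`C` part and assembly) and the SINGULARITY of the zoom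
  limit of cheap cascades (clause (3) of `ThinObject`)

Helper file (`--supports stmt-NavierStokesRegularity-24077 --as helper`, lead prover ns-tc-p1 g3) toward
the registered stub `stub_thinObjectExtraction` (S2, skeleton v5):

* `cknC_zoom_le` — the `C` part: `C(Q(z',r'); w) ≤ 2 C M` from the Type-I rate of the zoom
  (`|w|³ ≤ M(−s)^{-1/2}|w|²`), the transported `A` bound and `∫ (−s)^{-1/2} ≤ 2r'`;
* `exists_typeIBound_zoom_le` — **the uniform bound**: for every `M` there is `I < ∞` such that for
  every Tao frame with the Type-I rate (constant `M`), backward life `e^{2K}ρ² ≤ T`, and every `m ≤ K`,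
  Albritton–Barker's `𝐈(Q(2^m, 0); w, q, ∇w) ≤ I` for the zoom at `(T, x₀)` with scale `ρ` (the frame
  is restricted in time to the original vertex of each sub-cylinder and the now-proved 4th stub
  `UniformScaledEnergy` is applied there; `A`: `cknA_zoom_le`, `E`, `D`: `…ZoomTypeIBound`);
* `singularAt_zoomLimit_of_cheapCascades` — **clause (3)**: the KNSS zoom limit `W` of cheap cascades
  produced by `exists_typeIAncientMild_zoomLimit_of_cheapCascades` (`…ZoomLimit`) is singular at the
  origin, `SingularAt W 0` (`isBackwardSingularPoint_zoomLimit`, `…ZoomSingular`, fed with the uniform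
  bound; then `singularAt_zero_of_isBackwardSingularPoint`).

HONEST FRAMING: bookkeeping toward one registered stub of an open crux; nothing about Navier–Stokes
regularity is proved; no summit statement is proved by this file.
-/

noncomputable section

-- the summit-side namespace `Summit.NavierStokesRegularity.NavierStokesRegularity.…` (single-conjunct summit,
-- D-0017) repeats a component by design; the dupNamespace linter would flag every declaration.
set_option linter.dupNamespace false

namespace Summit.NavierStokesRegularity.NavierStokesRegularity.Theorems.ThinCascade

open MeasureTheory Set Function Metric Filter Topology
open scoped ENNReal NNReal
open Literature.Analysis Literature.Analysis.FluidPDE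
open Summit.NavierStokesRegularity.NavierStokesRegularity.Cruxes.TypeIQuantSubcubicExp.ThinCascade
  (TaoFrame CheapCascade SingularAt UniformScaledEnergy stub_uniformScaledEnergy)

/-! ### The `C` part -/

/-- **The `C` part of the uniform local Type-I bound of the zoom.**  For the zoom
`w = ρ • stPull (ρ²) ρ T x₀ u` with the Type-I rate `√(−s)‖w(s,y)‖ ≤ M` on the time window of the
sub-cylinder `Q(z', r')` (`z'.1 ≤ 0`), and the `A`-clause of `UniformScaledEnergy` for the frame at the
vertex `(T + ρ²z'.1, x₀ + ρz'.2)` and radius `ρr'`: `C(Q(z',r'); w) ≤ 2 C M`. [folklore] -/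
theorem cknC_zoom_le {ρ C T r' M : ℝ} (hρ : 0 < ρ) (hr' : 0 < r')
    {x₀ : EuclideanSpace ℝ (Fin 3)} {u : ℝ → EuclideanSpace ℝ (Fin 3) → EuclideanSpace ℝ (Fin 3)}
    {z' : ℝ × EuclideanSpace ℝ (Fin 3)} (hz' : z'.1 ≤ 0)
    (hrate : ∀ s ∈ Ioo (z'.1 - r' ^ 2) z'.1, ∀ y,
      Real.sqrt (-s) * ‖(ρ • stPull (ρ ^ 2) ρ T x₀ u) s y‖ ≤ M)
    (hA : ∀ t ∈ Icc (T + ρ ^ 2 * z'.1 - (ρ * r') ^ 2) (T + ρ ^ 2 * z'.1),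
      ∫⁻ x in ball (x₀ + ρ • z'.2) (ρ * r'), ENNReal.ofReal (‖u t x‖ ^ 2) ≤
        ENNReal.ofReal (C * (ρ * r'))) :
    cknC r' z' (ρ • stPull (ρ ^ 2) ρ T x₀ u) ≤ ENNReal.ofReal (2 * C * M) := by
  set w := ρ • stPull (ρ ^ 2) ρ T x₀ u with hw
  have hρ2 : 0 < ρ ^ 2 := by positivity
  -- `M ≥ 0` and `C ≥ 0` (the data are nonempty)
  have hs₀ : z'.1 - r' ^ 2 / 2 ∈ Ioo (z'.1 - r' ^ 2) z'.1 :=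
    ⟨by nlinarith [sq_nonneg r'], by nlinarith [sq_nonneg r', hr']⟩
  have hM0 : 0 ≤ M := le_trans (mul_nonneg (Real.sqrt_nonneg _) (norm_nonneg _)) (hrate _ hs₀ 0)
  -- the slice bound: `∫_{B(z'.2,r')} |w(s)|² ≤ C r'`
  have hslice2 : ∀ s ∈ Ioo (z'.1 - r' ^ 2) z'.1,
      ∫⁻ y in ball z'.2 r', ‖w s y‖ₑ ^ 2 ≤ ENNReal.ofReal (C * r') := by
    intro s hs
    rw [hw, lintegral_sq_ball_zoom hρ T x₀ u s z'.2 r']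
    have hs' : T + ρ ^ 2 * s ∈ Icc (T + ρ ^ 2 * z'.1 - (ρ * r') ^ 2) (T + ρ ^ 2 * z'.1) := by
      constructor
      · have := mul_le_mul_of_nonneg_left hs.1.le hρ2.le
        nlinarith
      · nlinarith [hs.2]
    have h1 : ∫⁻ x in ball (x₀ + ρ • z'.2) (ρ * r'), ‖u (T + ρ ^ 2 * s) x‖ₑ ^ 2 ≤
        ENNReal.ofReal (C * (ρ * r')) := by
      refine le_trans (le_of_eq (lintegral_congr fun x => ?_)) (hA _ hs')
      rw [← ofReal_norm, ENNReal.ofReal_pow (norm_nonneg _)]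
    calc (ENNReal.ofReal ρ)⁻¹ * ∫⁻ x in ball (x₀ + ρ • z'.2) (ρ * r'), ‖u (T + ρ ^ 2 * s) x‖ₑ ^ 2
        ≤ (ENNReal.ofReal ρ)⁻¹ * ENNReal.ofReal (C * (ρ * r')) := mul_le_mul' le_rfl h1
      _ = ENNReal.ofReal (C * r') := by
          rw [← ENNReal.ofReal_inv_of_pos hρ, ← ENNReal.ofReal_mul (by positivity)]
          congr 1
          field_simp
  -- the slice bound for the cube: `∫_{B} |w(s)|³ ≤ M (−s)^{-1/2} · C r'`
  have hslice3 : ∀ s ∈ Ioo (z'.1 - r' ^ 2) z'.1,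
      ∫⁻ y in ball z'.2 r', ‖w s y‖ₑ ^ (3 : ℕ) ≤
        ENNReal.ofReal (M * (-s) ^ (-(1 / 2 : ℝ))) * ENNReal.ofReal (C * r') := by
    intro s hs
    have hs0 : 0 < -s := by linarith [hs.2]
    have hpt : ∀ y, ‖w s y‖ₑ ≤ ENNReal.ofReal (M * (-s) ^ (-(1 / 2 : ℝ))) := by
      intro y
      rw [← ofReal_norm]
      refine ENNReal.ofReal_le_ofReal ?_
      have h := hrate s hs y
      have hsq : 0 < Real.sqrt (-s) := Real.sqrt_pos.2 hs0
      rw [Real.rpow_neg hs0.le, ← Real.sqrt_eq_rpow, ← div_eq_mul_inv, le_div_iff₀ hsq, mul_comm]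
      exact h
    calc ∫⁻ y in ball z'.2 r', ‖w s y‖ₑ ^ (3 : ℕ)
        ≤ ∫⁻ y in ball z'.2 r', ENNReal.ofReal (M * (-s) ^ (-(1 / 2 : ℝ))) * ‖w s y‖ₑ ^ 2 := by
          refine lintegral_mono fun y => ?_
          rw [show ‖w s y‖ₑ ^ (3 : ℕ) = ‖w s y‖ₑ * ‖w s y‖ₑ ^ 2 by ring]
          exact mul_le_mul' (hpt y) le_rfl
      _ = ENNReal.ofReal (M * (-s) ^ (-(1 / 2 : ℝ))) * ∫⁻ y in ball z'.2 r', ‖w s y‖ₑ ^ 2 :=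
          lintegral_const_mul' _ _ ENNReal.ofReal_ne_top
      _ ≤ _ := mul_le_mul' le_rfl (hslice2 s hs)
  -- Tonelli (inequality) and the time integral
  have hQ : ∫⁻ q in parabolicCylinder r' z', ‖w q.1 q.2‖ₑ ^ (3 : ℕ) ≤
      ENNReal.ofReal (C * r') * (ENNReal.ofReal M * ENNReal.ofReal (2 * Real.sqrt (z'.1 - (z'.1 - r' ^ 2)))) := by
    rw [parabolicCylinder, Measure.volume_eq_prod, ← Measure.prod_restrict]
    calc ∫⁻ q, ‖w q.1 q.2‖ₑ ^ (3 : ℕ) ∂(volume.restrict (Ioo (z'.1 - r' ^ 2) z'.1)).prod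
          (volume.restrict (ball z'.2 r'))
        ≤ ∫⁻ s in Ioo (z'.1 - r' ^ 2) z'.1, ∫⁻ y in ball z'.2 r', ‖w s y‖ₑ ^ (3 : ℕ) :=
          lintegral_prod_le _
      _ ≤ ∫⁻ s in Ioo (z'.1 - r' ^ 2) z'.1,
            ENNReal.ofReal (M * (-s) ^ (-(1 / 2 : ℝ))) * ENNReal.ofReal (C * r') :=
          lintegral_mono_ae ((ae_restrict_mem measurableSet_Ioo).mono hslice3)
      _ = ENNReal.ofReal (C * r') * (ENNReal.ofReal M *
            ∫⁻ s in Ioo (z'.1 - r' ^ 2) z'.1, ENNReal.ofReal ((-s) ^ (-(1 / 2 : ℝ)))) := by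
          rw [← lintegral_const_mul' _ _ ENNReal.ofReal_ne_top, ← lintegral_const_mul' _ _ ENNReal.ofReal_ne_top]
          refine lintegral_congr_ae ((ae_restrict_mem measurableSet_Ioo).mono fun s hs => ?_)
          dsimp only
          rw [ENNReal.ofReal_mul hM0]
          ring
      _ ≤ _ := by
          gcongr
          exact lintegral_rpow_neg_half_le (by nlinarith [sq_nonneg r']) hz'
  rw [show z'.1 - (z'.1 - r' ^ 2) = r' ^ 2 by ring, Real.sqrt_sq hr'.le] at hQ
  -- assemble
  rw [cknC]
  calc (ENNReal.ofReal r' ^ 2)⁻¹ * ∫⁻ q in parabolicCylinder r' z', ‖w q.1 q.2‖ₑ ^ (3 : ℕ)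
      ≤ (ENNReal.ofReal r' ^ 2)⁻¹ * (ENNReal.ofReal (C * r') * (ENNReal.ofReal M * ENNReal.ofReal (2 * r'))) :=
        mul_le_mul' le_rfl hQ
    _ ≤ ENNReal.ofReal (2 * C * M) := by
        by_cases hC : 0 ≤ C
        · rw [← ENNReal.ofReal_pow hr'.le, ← ENNReal.ofReal_inv_of_pos (by positivity),
            ← ENNReal.ofReal_mul hM0, ← ENNReal.ofReal_mul (by positivity), ← ENNReal.ofReal_mul (by positivity)]
          refine le_of_eq ?_
          congr 1
          field_simp
        · push Not at hC
          rw [ENNReal.ofReal_eq_zero.2 (by nlinarith : C * r' ≤ 0), zero_mul, mul_zero]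
          exact bot_le

/-! ### The uniform bound -/

/-- **The uniform local Type-I bound of the zooms.**  For every Type-I constant `M` there is `I < ∞`
such that: for every Tao frame `(T, u, p)` with the virtual Type-I bound `‖u(t,x)‖ ≤ M (T+τ−t)^{-1/2}`
(`τ > 0`), scale `ρ > 0` and backward life `e^{2K}ρ² ≤ T`, and every `m ≤ K`, Albritton–Barker's
Type-I quantity of the zoom at `(T, x₀)` on the cylinder `Q(2^m, 0)` is at most `I`:
`𝐈(Q(2^m,0); w, q, ∇w) ≤ I`, `w = ρ • stPull (ρ²) ρ T x₀ u`, `q = ρ² • stPull (ρ²) ρ T x₀ p`.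
(`UniformScaledEnergy` on the time-restricted frames; `A`, `E`, `D`, `C` parts.) [folklore] -/
theorem exists_typeIBound_zoom_le (M : ℝ) :
    ∃ I : ℝ≥0∞, I < ⊤ ∧
      ∀ {T τ ρ : ℝ} {K m : ℕ} (x₀ : EuclideanSpace ℝ (Fin 3))
        {u : ℝ → EuclideanSpace ℝ (Fin 3) → EuclideanSpace ℝ (Fin 3)} {p : ℝ → EuclideanSpace ℝ (Fin 3) → ℝ},
        TaoFrame T u p → 0 < τ → 0 < ρ → Real.exp (2 * K) * ρ ^ 2 ≤ T →
        (∀ t ∈ Icc 0 T, ∀ x : EuclideanSpace ℝ (Fin 3), ‖u t x‖ ≤ M * (T + τ - t) ^ (-(1 / 2 : ℝ))) →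
        m ≤ K →
          typeIBound (parabolicCylinder ((2 : ℝ) ^ m) (0 : ℝ × EuclideanSpace ℝ (Fin 3)))
            (ρ • stPull (ρ ^ 2) ρ T x₀ u) (ρ ^ 2 • stPull (ρ ^ 2) ρ T x₀ p)
            (fun s y => fderiv ℝ ((ρ • stPull (ρ ^ 2) ρ T x₀ u) s) y) ≤ I := by
  obtain ⟨C, hC⟩ := stub_uniformScaledEnergy M
  refine ⟨ENNReal.ofReal C + ENNReal.ofReal (2 * C * M) + ENNReal.ofReal C + ENNReal.ofReal (3 * C),
    ENNReal.add_lt_top.2 ⟨ENNReal.add_lt_top.2 ⟨ENNReal.add_lt_top.2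
      ⟨ENNReal.ofReal_lt_top, ENNReal.ofReal_lt_top⟩, ENNReal.ofReal_lt_top⟩, ENNReal.ofReal_lt_top⟩, ?_⟩
  intro T τ ρ K m x₀ u p hfr hτ hρ hlife hrate hm
  set w := ρ • stPull (ρ ^ 2) ρ T x₀ u with hw
  set q := ρ ^ 2 • stPull (ρ ^ 2) ρ T x₀ p with hq
  have hρ2 : 0 < ρ ^ 2 := by positivity
  -- the zoom's Type-I rate on the slab `(−e^{2K}, 0)`
  have hz := zoom_of_cheapCascade (K := K) x₀ hfr hτ hρ hlife hrate
  -- `4^m ≤ e^{2K}`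
  have h4m : (4 : ℝ) ^ m ≤ Real.exp (2 * K) := by
    refine (four_pow_le_exp_two_mul m).trans (Real.exp_le_exp.2 ?_)
    exact_mod_cast Nat.mul_le_mul_left 2 hm
  refine typeIBound_le_iff.2 fun r' hr' z' hsub => ?_
  -- geometry of the sub-cylinder
  obtain ⟨hz'0, hz'R⟩ := subcylinder_time_bounds hr' hsub
  have hR2 : ((2 : ℝ) ^ m) ^ 2 = (4 : ℝ) ^ m := by rw [← pow_mul, mul_comm, pow_mul]; norm_num
  rw [hR2] at hz'R
  -- the original vertex `t⋆ = T + ρ² z'.1` and the restricted frame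
  set tstar : ℝ := T + ρ ^ 2 * z'.1 with htstar
  have hRt : (ρ * r') ^ 2 ≤ tstar := by
    have h1 : ρ ^ 2 * (r' ^ 2 - z'.1) ≤ ρ ^ 2 * (4 : ℝ) ^ m := mul_le_mul_of_nonneg_left (by linarith) hρ2.le
    have h2 : ρ ^ 2 * (4 : ℝ) ^ m ≤ T := le_trans (by nlinarith) hlife
    rw [htstar]; nlinarith
  have htpos : 0 < tstar := lt_of_lt_of_le (by positivity) hRt
  have htle : tstar ≤ T := by rw [htstar]; nlinarith
  have hfr' : TaoFrame tstar u p := frame_restrict hfr htpos htle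
  have hrate' := typeI_restrict hrate htle
  have hτ' : 0 < T - tstar + τ := by linarith
  obtain ⟨hA, hE, hD⟩ := hC tstar (T - tstar + τ) u p hfr' hτ' hrate' (x₀ + ρ • z'.2) (ρ * r')
    (by positivity) hRt
  -- the four parts
  have hAz : cknAEss r' z' w ≤ ENNReal.ofReal C :=
    cknAEss_le_cknA.trans (cknA_zoom_le (z := z') hρ hr' hA)
  have hEz : cknE r' z' (fun s y => fderiv ℝ (w s) y) ≤ ENNReal.ofReal (3 * C) := cknE_zoom_le hρ hr' hE
  have hDz : cknDOsc r' z' q ≤ ENNReal.ofReal C := cknDOsc_zoom_le hρ hr' hD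
  have hCz : cknC r' z' w ≤ ENNReal.ofReal (2 * C * M) := by
    refine cknC_zoom_le hρ hr' hz'0 (fun s hs y => ?_) hA
    refine (hz.2.2.2 s ⟨?_, lt_of_lt_of_le hs.2 hz'0⟩ y)
    have : -Real.exp (2 * K) ≤ -(4 : ℝ) ^ m := by linarith
    exact lt_of_le_of_lt (this.trans hz'R) hs.1
  calc abScaledSum r' z' w q (fun s y => fderiv ℝ (w s) y)
      = cknAEss r' z' w + cknC r' z' w + cknDOsc r' z' q + cknE r' z' (fun s y => fderiv ℝ (w s) y) := rfl
    _ ≤ ENNReal.ofReal C + ENNReal.ofReal (2 * C * M) + ENNReal.ofReal C + ENNReal.ofReal (3 * C) := by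
        gcongr

/-! ### Clause (3): the zoom limit is singular at the origin -/

/-- **Clause (3) of `ThinObject` for the zoom limit of cheap cascades.**  In the setting of
`exists_typeIAncientMild_zoomLimit_of_cheapCascades` (cheap cascades `(T_K, τ_K, ρ_K, x₀^K, u_K, p_K)` of
every length with constants `(M, q)`, a strictly increasing `φ` and the KNSS zoom limit `W` with
pointwise convergence of the zooms on the open past), `W` is singular at the space–time origin:
`SingularAt W 0`.  Proof: the zooms have uniformly bounded Albritton–Barker quantity on every
`Q(2^m, 0)` (`exists_typeIBound_zoom_le`), blow up at the origin by the centre values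
(`…ZoomBlowup`), so the limit is a backward singular point (`isBackwardSingularPoint_zoomLimit`), hence
singular (`singularAt_zero_of_isBackwardSingularPoint`). [folklore] -/
theorem singularAt_zoomLimit_of_cheapCascades {M q : ℝ} {T τ ρ : ℕ → ℝ}
    {x₀ : ℕ → EuclideanSpace ℝ (Fin 3)}
    {u : ℕ → ℝ → EuclideanSpace ℝ (Fin 3) → EuclideanSpace ℝ (Fin 3)}
    {p : ℕ → ℝ → EuclideanSpace ℝ (Fin 3) → ℝ}
    (hdata : ∀ K : ℕ, TaoFrame (T K) (u K) (p K) ∧ 0 < τ K ∧ 0 < ρ K ∧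
        Real.exp (2 * K) * ρ K ^ 2 ≤ T K ∧
        τ K ≤ M ^ 2 * Real.exp (-2 * (K : ℝ)) * ρ K ^ 2 ∧
        (∀ t ∈ Icc 0 (T K), ∀ x : EuclideanSpace ℝ (Fin 3),
          ‖u K t x‖ ≤ M * (T K + τ K - t) ^ (-(1 / 2 : ℝ))) ∧
        Real.exp K ≤ ρ K * ‖u K (T K) (x₀ K)‖ ∧
        ∀ j : ℕ, 1 ≤ j → j ≤ K →
          ∫⁻ x in {x : EuclideanSpace ℝ (Fin 3) | ρ K < ‖x - x₀ K‖ ∧ ‖x - x₀ K‖ < Real.exp j * ρ K},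
              ENNReal.ofReal (‖u K (T K) x‖ ^ 3) ≤ ENNReal.ofReal (q * j))
    {φ : ℕ → ℕ} (hφ : StrictMono φ) {W : ℝ → EuclideanSpace ℝ (Fin 3) → EuclideanSpace ℝ (Fin 3)}
    (hpt : ∀ t < 0, ∀ x, Tendsto
      (fun j => ((ρ (φ j)) • stPull (ρ (φ j) ^ 2) (ρ (φ j)) (T (φ j)) (x₀ (φ j)) (u (φ j))) t x)
      atTop (𝓝 (W t x))) :
    SingularAt W 0 := by
  obtain ⟨I, hI, hbd⟩ := exists_typeIBound_zoom_le M
  refine singularAt_zero_of_isBackwardSingularPoint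
    (isBackwardSingularPoint_zoomLimit (fun K => (hdata K).1.1) (fun K => (hdata K).2.2.1)
      (fun K => (hdata K).2.2.2.1) (fun K => (hdata K).2.2.2.2.2.2.1) hφ hpt hI fun m j hmj => ?_)
  exact hbd (x₀ (φ j)) (hdata (φ j)).1 (hdata (φ j)).2.1 (hdata (φ j)).2.2.1 (hdata (φ j)).2.2.2.1
    (hdata (φ j)).2.2.2.2.2.1 (hmj.trans (hφ.id_le j))

end Summit.NavierStokesRegularity.NavierStokesRegularity.Theorems.ThinCascade

end
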